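import Mathlib
import HarnessLib
import Summits.HubbardSuperconductivity.HubbardSuperconductivity.Theorems.KLProgrammePerturbedFermiCurveTwoFrameGraded2
import Summits.HubbardSuperconductivity.HubbardSuperconductivity.Theorems.KLProgrammePerturbedFermiCurveFrameDiffTransport
import Summits.HubbardSuperconductivity.HubbardSuperconductivity.Theorems.KLProgrammePerturbedFermiCurveCompDiff

/-!
# Route `KLProgramme` — K3 engine child (stmt-HubbardSuperconductivity-19918, `stub_twoLeg_step`, clause (E3a-MS) `TwoLegSizesMST`):
# the composite difference in TWO-PARAMETER graded form (`E₀ ≤ e₀`, `E_i ≤ e·λ^i`, `i ≥ 1`) — the one-call form of (P2) for (F)'s profile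

Cell `gate-hubbard-kl`, seat hubbard-kl-k3c3-p3 (g3) «implicit-function / monotonicity route for μ(n)», part (P2) of the (L)+(F) recipe.
Companion of `…CompDiffGraded`: same hypotheses except that the order-0 difference size `e₀` is carried separately (in slot `m` of (F):
`e₀ ≍ U²4^{−n−m}` by Jackson of order one, `e ≍ U²16^{−m}`, `λ = 2·4^m`).  With a `C⁵` symbol `F`, global nested `‖DᵏF‖ ≤ M_k`:

* `abs_comp_sub_le_graded₂_zero`:  `|F(γ_{K′}θ) − F(γ_Kθ)| ≤ 12.2·M₁·e₀`;
* `abs_iteratedDeriv_comp_sub_le_graded₂_one`:   `≤ e·1420·M₁λ + e₀·(3.64·10⁴·M₁ + 2.82·10³·M₂)`;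
* `abs_iteratedDeriv_comp_sub_le_graded₂_two`:   `≤ e·(1.29·10⁷·M₁λ² + 6.57·10⁵·M₂λ) + e₀·(3.38·10⁸·M₁λ + 2.54·10⁷·M₂ + 6.52·10⁵·M₃)`;
* `abs_iteratedDeriv_comp_sub_le_graded₂_three`: `≤ e·(1.99·10¹¹·M₁λ³ + 1.2·10¹⁰·M₂λ² + 2.28·10⁸·M₃λ)
  + e₀·(5.23·10¹²·M₁λ² + 3.92·10¹¹·M₂λ + 1.18·10¹⁰·M₃ + 1.51·10⁸·M₄)`;
* `abs_iteratedDeriv_comp_sub_le_graded₂_four`:  `≤ e·(4.3·10¹⁵·M₁λ⁴ + 2.76·10¹⁴·M₂λ³ + 6.89·10¹²·M₃λ² + 7.01·10¹⁰·M₄λ)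
  + e₀·(1.14·10¹⁷·M₁λ² + 8.49·10¹⁵·M₂λ² + 2.72·10¹⁴·M₃λ + 4.53·10¹²·M₄ + 3.48·10¹⁰·M₅) + 6.92·10¹⁰·M₁·A₄`.

Reading for the budget table (slot `m`, scale `n < m`, `λ = 2·4^m`): `e·M_kλ^{j+1−k}` is the term of `…CompDiffGraded` (budget shape at
`k = 1`); the `e₀`-terms carry at most `λ²` and `e₀λ² ≍ U²4^{m−n}·4`, against budgets `∝ 4^{(j−2)m}` with `j ≥ 3` where `λ²` occurs.
Everything is PROVED; no definitions, no named facts. [cite: BenfattoGiulianiMastropietro2006, §2.4 Lemma 2.1 (2.40)]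
-/

noncomputable section

namespace Summit.HubbardSuperconductivity.HubbardSuperconductivity.Theorems.PerturbedFermiCurve

set_option linter.dupNamespace false -- summit = problem name (single-conjunct summit), D-0017
set_option maxSynthPendingDepth 4 -- nested operator-norm instances (up to fifth Fréchet derivatives)

open Real Set
open Literature.MathematicalPhysics.QuantumLattice Literature.MathematicalPhysics.QuantumLattice.BandSectorCounting
open Summit.HubbardSuperconductivity.HubbardSuperconductivity.Theorems.DispersionFlow
open Summit.HubbardSuperconductivity.HubbardSuperconductivity.Theorems.KLRegimeSplit

/-! ## §1 The data of the two curves in `iteratedDeriv` form -/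

section CompGraded

variable {K K' : TrigPolyC4v} {A : ℝ}
  (hA : ∀ p : Momentum, ∀ j ≤ 2, ‖iteratedFDeriv ℝ j (frameShift K) p‖ ≤ A)
  (hA' : ∀ p : Momentum, ∀ j ≤ 2, ‖iteratedFDeriv ℝ j (frameShift K') p‖ ≤ A) (hA20 : A ≤ 1 / 20)
  (hd : klCurveD ≤ (bandBounds (show (-4 : ℝ) < -1.1 by norm_num) (show (-1.1 : ℝ) ≤ -0.1 by norm_num)
    (show (-0.1 : ℝ) < 0 by norm_num)).Dtmin - 2 * A)
  {ν : ℝ} (hlo : (-1.1 : ℝ) ≤ ν - A) (hhi : ν + A ≤ -0.1)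
  {A₃ A₄ e e₀ l : ℝ} (he : 0 ≤ e) (he₀ : 0 ≤ e₀) (hl : 1 ≤ l)
  (hA₃ : ∀ p : Momentum, ‖iteratedFDeriv ℝ 3 (frameShift K) p‖ ≤ A₃)
  (hA₃' : ∀ p : Momentum, ‖iteratedFDeriv ℝ 3 (frameShift K') p‖ ≤ A₃) (hA₃l : A₃ ≤ l)
  (hA₄ : ∀ p : Momentum, ‖iteratedFDeriv ℝ 4 (frameShift K) p‖ ≤ A₄)
  (hA₄' : ∀ p : Momentum, ‖iteratedFDeriv ℝ 4 (frameShift K') p‖ ≤ A₄) (hA₄l : A₄ ≤ l ^ 2)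
  (hE₀ : ∀ k : Fin 2 → ℝ, (∀ i, |k i| ≤ π) → |(fun p : Fin 2 → ℝ => -K'.eval p) k - (fun p : Fin 2 → ℝ => -K.eval p) k| ≤ e₀)
  (hE₁ : ∀ k : Fin 2 → ℝ, (∀ i, |k i| ≤ π) →
    ‖fderiv ℝ (fun p : Fin 2 → ℝ => -K'.eval p) k - fderiv ℝ (fun p : Fin 2 → ℝ => -K.eval p) k‖ ≤ e * l)
  (hE₂ : ∀ k : Fin 2 → ℝ, (∀ i, |k i| ≤ π) →
    ‖fderiv ℝ (fderiv ℝ (fun p : Fin 2 → ℝ => -K'.eval p)) k - fderiv ℝ (fderiv ℝ (fun p : Fin 2 → ℝ => -K.eval p)) k‖ ≤ e * l ^ 2)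
  (hE₃ : ∀ k : Fin 2 → ℝ, (∀ i, |k i| ≤ π) →
    ‖fderiv ℝ (fderiv ℝ (fderiv ℝ (fun p : Fin 2 → ℝ => -K'.eval p))) k -
      fderiv ℝ (fderiv ℝ (fderiv ℝ (fun p : Fin 2 → ℝ => -K.eval p))) k‖ ≤ e * l ^ 3)
  (hE₄ : ∀ k : Fin 2 → ℝ, (∀ i, |k i| ≤ π) →
    ‖fderiv ℝ (fderiv ℝ (fderiv ℝ (fderiv ℝ (fun p : Fin 2 → ℝ => -K'.eval p)))) k -
      fderiv ℝ (fderiv ℝ (fderiv ℝ (fderiv ℝ (fun p : Fin 2 → ℝ => -K.eval p)))) k‖ ≤ e * l ^ 4)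
include hA hA' hA20 hd hlo hhi he he₀ hl hA₃ hA₃' hA₃l hA₄ hA₄' hA₄l hE₀ hE₁ hE₂ hE₃ hE₄

/-- **The two curves in `iteratedDeriv` form, graded**: `γ_K, γ_{K′}` are `C⁴`; `‖γ⁽¹⁾‖ ≤ 231`, `‖γ⁽²⁾‖ ≤ 7·10⁵`, `‖γ⁽³⁾‖ ≤ 6.66·10⁹·λ`,
`‖γ⁽⁴⁾‖ ≤ 1.03736·10¹⁴·λ²` (both curves); `‖γ_{K′} − γ_K‖ ≤ 12.2e₀`; differences as in
`norm_iteratedFDeriv_fermiPointLp_sub_le_graded₂` (two-parameter). [folklore] -/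
theorem comp_graded₂_data (θ : ℝ) :
    ContDiff ℝ 4 (fun θ : ℝ => (WithLp.toLp 2 (klFermiPoint ν K θ) : Momentum)) ∧
    ContDiff ℝ 4 (fun θ : ℝ => (WithLp.toLp 2 (klFermiPoint ν K' θ) : Momentum)) ∧
    (‖iteratedDeriv 1 (fun θ : ℝ => (WithLp.toLp 2 (klFermiPoint ν K θ) : Momentum)) θ‖ ≤ 231 ∧
      ‖iteratedDeriv 1 (fun θ : ℝ => (WithLp.toLp 2 (klFermiPoint ν K' θ) : Momentum)) θ‖ ≤ 231 ∧
      ‖iteratedDeriv 2 (fun θ : ℝ => (WithLp.toLp 2 (klFermiPoint ν K θ) : Momentum)) θ‖ ≤ 700000 ∧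
      ‖iteratedDeriv 2 (fun θ : ℝ => (WithLp.toLp 2 (klFermiPoint ν K' θ) : Momentum)) θ‖ ≤ 700000 ∧
      ‖iteratedDeriv 3 (fun θ : ℝ => (WithLp.toLp 2 (klFermiPoint ν K θ) : Momentum)) θ‖ ≤ 6660000000 * l ∧
      ‖iteratedDeriv 3 (fun θ : ℝ => (WithLp.toLp 2 (klFermiPoint ν K' θ) : Momentum)) θ‖ ≤ 6660000000 * l ∧
      ‖iteratedDeriv 4 (fun θ : ℝ => (WithLp.toLp 2 (klFermiPoint ν K' θ) : Momentum)) θ‖ ≤ 103736000000000 * l ^ 2) ∧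
    ‖(WithLp.toLp 2 (klFermiPoint ν K' θ) : Momentum) - WithLp.toLp 2 (klFermiPoint ν K θ)‖ ≤ 12.2 * e₀ ∧
    ‖iteratedDeriv 1 (fun θ : ℝ => (WithLp.toLp 2 (klFermiPoint ν K' θ) : Momentum)) θ -
        iteratedDeriv 1 (fun θ : ℝ => (WithLp.toLp 2 (klFermiPoint ν K θ) : Momentum)) θ‖ ≤ 1420 * e * l + 36400 * e₀ ∧
    ‖iteratedDeriv 2 (fun θ : ℝ => (WithLp.toLp 2 (klFermiPoint ν K' θ) : Momentum)) θ -
        iteratedDeriv 2 (fun θ : ℝ => (WithLp.toLp 2 (klFermiPoint ν K θ) : Momentum)) θ‖ ≤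
      12900000 * e * l ^ 2 + 338000000 * e₀ * l ∧
    ‖iteratedDeriv 3 (fun θ : ℝ => (WithLp.toLp 2 (klFermiPoint ν K' θ) : Momentum)) θ -
        iteratedDeriv 3 (fun θ : ℝ => (WithLp.toLp 2 (klFermiPoint ν K θ) : Momentum)) θ‖ ≤
      199000000000 * e * l ^ 3 + 5230000000000 * e₀ * l ^ 2 ∧
    ‖iteratedDeriv 4 (fun θ : ℝ => (WithLp.toLp 2 (klFermiPoint ν K' θ) : Momentum)) θ -
        iteratedDeriv 4 (fun θ : ℝ => (WithLp.toLp 2 (klFermiPoint ν K θ) : Momentum)) θ‖ ≤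
      4300000000000000 * e * l ^ 4 + 114000000000000000 * e₀ * l ^ 2 + 69200000000 * A₄ := by
  have hA₃0 : 0 ≤ A₃ := (norm_nonneg _).trans (hA₃ 0)
  have hA₄0 : 0 ≤ A₄ := (norm_nonneg _).trans (hA₄ 0)
  have hl0 : 0 ≤ l := zero_le_one.trans hl
  have hl2 : 1 ≤ l ^ 2 := one_le_pow₀ hl
  obtain ⟨hγ, g1, g2, g3, g4⟩ := fermiPointLp_sizes_of_sizes hA hA20 hd hlo hhi hA₃ hA₄ θ
  obtain ⟨hγ', g1', g2', g3', g4'⟩ := fermiPointLp_sizes_of_sizes hA' hA20 hd hlo hhi hA₃' hA₄' θ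
  obtain ⟨d0, d1, d2, d3, d4⟩ := norm_iteratedFDeriv_fermiPointLp_sub_le_graded₂ hA hA' hA20 hd hlo hhi he he₀ hl hA₃ hA₃' hA₃l hA₄ hA₄'
    hA₄l hE₀ hE₁ hE₂ hE₃ hE₄ θ
  have hD1 := klCurveD1_le
  have hD2 := klCurveD2_le
  have hD3 : klCurveD3 A₃ ≤ 6660000000 * l := (klCurveD3_le hA₃0).trans (by nlinarith)
  have hD4 : klCurveD4 A₃ A₄ ≤ 103736000000000 * l ^ 2 := (klCurveD4_le hA₃0 hA₄0).trans (by nlinarith)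
  have c := fun (n : ℕ) (hn : (n : WithTop ℕ∞) ≤ 4) =>
    norm_iteratedDeriv_sub_eq_norm_iteratedFDeriv_sub (hγ.contDiffAt.of_le hn) (hγ'.contDiffAt.of_le hn) (x := θ)
  refine ⟨hγ, hγ', ⟨?_, ?_, ?_, ?_, ?_, ?_, ?_⟩, d0, ?_, ?_, ?_, ?_⟩
  · rw [← norm_iteratedFDeriv_eq_norm_iteratedDeriv]; exact g1.trans hD1
  · rw [← norm_iteratedFDeriv_eq_norm_iteratedDeriv]; exact g1'.trans hD1
  · rw [← norm_iteratedFDeriv_eq_norm_iteratedDeriv]; exact g2.trans hD2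
  · rw [← norm_iteratedFDeriv_eq_norm_iteratedDeriv]; exact g2'.trans hD2
  · rw [← norm_iteratedFDeriv_eq_norm_iteratedDeriv]; exact g3.trans hD3
  · rw [← norm_iteratedFDeriv_eq_norm_iteratedDeriv]; exact g3'.trans hD3
  · rw [← norm_iteratedFDeriv_eq_norm_iteratedDeriv]; exact g4'.trans hD4
  · rw [c 1 (by norm_num)]; exact d1
  · rw [c 2 (by norm_num)]; exact d2
  · rw [c 3 (by norm_num)]; exact d3
  · rw [c 4 (by norm_num)]; exact d4

/-! ## §2 The composite differences, graded -/

variable {F : Momentum → ℝ} (hF : ContDiff ℝ 5 F) {M₁ M₂ M₃ M₄ M₅ : ℝ}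
  (hM₁ : ∀ z, ‖fderiv ℝ F z‖ ≤ M₁) (hM₂ : ∀ z, ‖fderiv ℝ (fderiv ℝ F) z‖ ≤ M₂)
  (hM₃ : ∀ z, ‖fderiv ℝ (fderiv ℝ (fderiv ℝ F)) z‖ ≤ M₃) (hM₄ : ∀ z, ‖fderiv ℝ (fderiv ℝ (fderiv ℝ (fderiv ℝ F))) z‖ ≤ M₄)
  (hM₅ : ∀ z, ‖fderiv ℝ (fderiv ℝ (fderiv ℝ (fderiv ℝ (fderiv ℝ F)))) z‖ ≤ M₅)

section Zero
include hF hM₁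

/-- **Order 0**: `|F(γ_{K′}θ) − F(γ_Kθ)| ≤ 12.2·M₁·e₀`. [folklore] -/
theorem abs_comp_sub_le_graded₂_zero (θ : ℝ) :
    |F (WithLp.toLp 2 (klFermiPoint ν K' θ)) - F (WithLp.toLp 2 (klFermiPoint ν K θ))| ≤ 12.2 * M₁ * e₀ := by
  obtain ⟨-, -, -, d0, -⟩ := comp_graded₂_data hA hA' hA20 hd hlo hhi he he₀ hl hA₃ hA₃' hA₃l hA₄ hA₄' hA₄l hE₀ hE₁ hE₂ hE₃ hE₄ θ
  have hM0 : 0 ≤ M₁ := (norm_nonneg _).trans (hM₁ 0)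
  have hmv := (convex_univ).norm_image_sub_le_of_norm_fderiv_le (𝕜 := ℝ) (f := F)
    (fun z _ => (hF.differentiable (by norm_num)) z) (fun z _ => hM₁ z) (mem_univ (WithLp.toLp 2 (klFermiPoint ν K θ)))
    (mem_univ (WithLp.toLp 2 (klFermiPoint ν K' θ)))
  rw [Real.norm_eq_abs] at hmv
  refine hmv.trans ?_
  have := mul_le_mul_of_nonneg_left d0 hM0
  linarith

end Zero

include hF hM₁ hM₂ in
/-- **Order 1**: `≤ e·1420·M₁λ + e₀·(3.64·10⁴·M₁ + 2.82·10³·M₂)`. [folklore] -/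
theorem abs_iteratedDeriv_comp_sub_le_graded₂_one (θ : ℝ) :
    |iteratedDeriv 1 (F ∘ fun θ : ℝ => (WithLp.toLp 2 (klFermiPoint ν K' θ) : Momentum)) θ -
        iteratedDeriv 1 (F ∘ fun θ : ℝ => (WithLp.toLp 2 (klFermiPoint ν K θ) : Momentum)) θ| ≤
      e * (1420 * M₁ * l) + e₀ * (36400 * M₁ + 2820 * M₂) := by
  obtain ⟨hγ, hγ', ⟨-, g1', -, -, -, -, -⟩, d0, d1, -, -, -⟩ :=
    comp_graded₂_data hA hA' hA20 hd hlo hhi he he₀ hl hA₃ hA₃' hA₃l hA₄ hA₄' hA₄l hE₀ hE₁ hE₂ hE₃ hE₄ θ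
  have hM₂0 : 0 ≤ M₂ := (norm_nonneg _).trans (hM₂ 0)
  have hΦ₁ := (norm_fderiv_sub_le_of_global hF hM₂ (WithLp.toLp 2 (klFermiPoint ν K' θ)) (WithLp.toLp 2 (klFermiPoint ν K θ))).trans
    (mul_le_mul_of_nonneg_left d0 hM₂0)
  have h := abs_iteratedDeriv_one_comp_sub_le (hF.of_le (by norm_num)) hγ hγ' (hM₁ _) hΦ₁ g1' d1
  refine h.trans ?_
  nlinarith [mul_nonneg hM₂0 he₀]

include hF hM₁ hM₂ hM₃ in
/-- **Order 2**: `≤ e·(1.29·10⁷·M₁λ² + 6.57·10⁵·M₂λ) + e₀·(3.38·10⁸·M₁λ + 2.54·10⁷·M₂ + 6.52·10⁵·M₃)`. [folklore] -/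
theorem abs_iteratedDeriv_comp_sub_le_graded₂_two (θ : ℝ) :
    |iteratedDeriv 2 (F ∘ fun θ : ℝ => (WithLp.toLp 2 (klFermiPoint ν K' θ) : Momentum)) θ -
        iteratedDeriv 2 (F ∘ fun θ : ℝ => (WithLp.toLp 2 (klFermiPoint ν K θ) : Momentum)) θ| ≤
      e * (12900000 * M₁ * l ^ 2 + 657000 * M₂ * l) + e₀ * (338000000 * M₁ * l + 25400000 * M₂ + 652000 * M₃) := by
  obtain ⟨hγ, hγ', ⟨g1, g1', -, g2', -, -, -⟩, d0, d1, d2, -, -⟩ :=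
    comp_graded₂_data hA hA' hA20 hd hlo hhi he he₀ hl hA₃ hA₃' hA₃l hA₄ hA₄' hA₄l hE₀ hE₁ hE₂ hE₃ hE₄ θ
  have hM₂0 : 0 ≤ M₂ := (norm_nonneg _).trans (hM₂ 0)
  have hM₃0 : 0 ≤ M₃ := (norm_nonneg _).trans (hM₃ 0)
  have hΦ₁ := (norm_fderiv_sub_le_of_global hF hM₂ (WithLp.toLp 2 (klFermiPoint ν K' θ)) (WithLp.toLp 2 (klFermiPoint ν K θ))).trans
    (mul_le_mul_of_nonneg_left d0 hM₂0)
  have hΦ₂ := (norm_fderiv_two_sub_le_of_global hF hM₃ (WithLp.toLp 2 (klFermiPoint ν K' θ))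
    (WithLp.toLp 2 (klFermiPoint ν K θ))).trans (mul_le_mul_of_nonneg_left d0 hM₃0)
  have h := abs_iteratedDeriv_two_comp_sub_le (hF.of_le (by norm_num)) hγ hγ' (hM₁ _) (hM₂ _) hΦ₁ hΦ₂ g1 g1' g2' d1 d2
  refine h.trans ?_
  nlinarith [mul_nonneg hM₃0 he₀, mul_nonneg hM₂0 he₀, mul_nonneg hM₂0 he]

include hF hM₁ hM₂ hM₃ hM₄ in
/-- **Order 3**: `≤ e·(1.99·10¹¹·M₁λ³ + 1.2·10¹⁰·M₂λ² + 2.28·10⁸·M₃λ) + e₀·(5.23·10¹²·M₁λ² + 3.92·10¹¹·M₂λ + 1.18·10¹⁰·M₃ + 1.51·10⁸·M₄)`.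
[folklore] -/
theorem abs_iteratedDeriv_comp_sub_le_graded₂_three (θ : ℝ) :
    |iteratedDeriv 3 (F ∘ fun θ : ℝ => (WithLp.toLp 2 (klFermiPoint ν K' θ) : Momentum)) θ -
        iteratedDeriv 3 (F ∘ fun θ : ℝ => (WithLp.toLp 2 (klFermiPoint ν K θ) : Momentum)) θ| ≤
      e * (199000000000 * M₁ * l ^ 3 + 12000000000 * M₂ * l ^ 2 + 228000000 * M₃ * l) +
        e₀ * (5230000000000 * M₁ * l ^ 2 + 392000000000 * M₂ * l + 11800000000 * M₃ + 151000000 * M₄) := by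
  obtain ⟨hγ, hγ', ⟨g1, g1', g2, g2', -, g3', -⟩, d0, d1, d2, d3, -⟩ :=
    comp_graded₂_data hA hA' hA20 hd hlo hhi he he₀ hl hA₃ hA₃' hA₃l hA₄ hA₄' hA₄l hE₀ hE₁ hE₂ hE₃ hE₄ θ
  have hM₂0 : 0 ≤ M₂ := (norm_nonneg _).trans (hM₂ 0)
  have hM₃0 : 0 ≤ M₃ := (norm_nonneg _).trans (hM₃ 0)
  have hM₄0 : 0 ≤ M₄ := (norm_nonneg _).trans (hM₄ 0)
  have hΦ₁ := (norm_fderiv_sub_le_of_global hF hM₂ (WithLp.toLp 2 (klFermiPoint ν K' θ)) (WithLp.toLp 2 (klFermiPoint ν K θ))).trans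
    (mul_le_mul_of_nonneg_left d0 hM₂0)
  have hΦ₂ := (norm_fderiv_two_sub_le_of_global hF hM₃ (WithLp.toLp 2 (klFermiPoint ν K' θ))
    (WithLp.toLp 2 (klFermiPoint ν K θ))).trans (mul_le_mul_of_nonneg_left d0 hM₃0)
  have hΦ₃ := (norm_fderiv_three_sub_le_of_global hF hM₄ (WithLp.toLp 2 (klFermiPoint ν K' θ))
    (WithLp.toLp 2 (klFermiPoint ν K θ))).trans (mul_le_mul_of_nonneg_left d0 hM₄0)
  have h := abs_iteratedDeriv_three_comp_sub_le (hF.of_le (by norm_num)) hγ hγ' (hM₁ _) (hM₂ _) (hM₃ _) hΦ₁ hΦ₂ hΦ₃ g1 g1' g2 g2'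
    g3' d1 d2 d3
  refine h.trans ?_
  have hl0 : 0 ≤ l := zero_le_one.trans hl
  have m2a : M₂ * (e * l ^ 1) ≤ M₂ * (e * l ^ 2) := graded_mono_mul hM₂0 he hl (by norm_num)
  have n2 : M₂ * (e₀ * l ^ 0) ≤ M₂ * (e₀ * l ^ 1) := graded_mono_mul hM₂0 he₀ hl (by norm_num)
  simp only [pow_zero, mul_one, pow_one] at m2a n2
  nlinarith [m2a, n2, mul_nonneg hM₄0 he₀, mul_nonneg hM₃0 he₀, mul_nonneg hM₂0 he₀, mul_nonneg hM₃0 he, mul_nonneg hM₂0 he,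
    mul_nonneg (mul_nonneg hM₂0 he) hl0, mul_nonneg (mul_nonneg hM₃0 he) hl0, mul_nonneg (mul_nonneg hM₂0 he₀) hl0]

include hF hM₁ hM₂ hM₃ hM₄ hM₅ in
/-- **Order 4**: `≤ e·(4.3·10¹⁵·M₁λ⁴ + 2.76·10¹⁴·M₂λ³ + 6.89·10¹²·M₃λ² + 7.01·10¹⁰·M₄λ)
+ e₀·(1.14·10¹⁷·M₁λ² + 8.49·10¹⁵·M₂λ² + 2.72·10¹⁴·M₃λ + 4.53·10¹²·M₄ + 3.48·10¹⁰·M₅) + 6.92·10¹⁰·M₁·A₄`. [folklore] -/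
theorem abs_iteratedDeriv_comp_sub_le_graded₂_four (θ : ℝ) :
    |iteratedDeriv 4 (F ∘ fun θ : ℝ => (WithLp.toLp 2 (klFermiPoint ν K' θ) : Momentum)) θ -
        iteratedDeriv 4 (F ∘ fun θ : ℝ => (WithLp.toLp 2 (klFermiPoint ν K θ) : Momentum)) θ| ≤
      e * (4300000000000000 * M₁ * l ^ 4 + 276000000000000 * M₂ * l ^ 3 + 6890000000000 * M₃ * l ^ 2 + 70100000000 * M₄ * l) +
        e₀ * (114000000000000000 * M₁ * l ^ 2 + 8490000000000000 * M₂ * l ^ 2 + 272000000000000 * M₃ * l + 4530000000000 * M₄ +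
          34800000000 * M₅) + 69200000000 * M₁ * A₄ := by
  obtain ⟨hγ, hγ', ⟨g1, g1', g2, g2', g3, g3', g4'⟩, d0, d1, d2, d3, d4⟩ :=
    comp_graded₂_data hA hA' hA20 hd hlo hhi he he₀ hl hA₃ hA₃' hA₃l hA₄ hA₄' hA₄l hE₀ hE₁ hE₂ hE₃ hE₄ θ
  have hM₁0 : 0 ≤ M₁ := (norm_nonneg _).trans (hM₁ 0)
  have hM₂0 : 0 ≤ M₂ := (norm_nonneg _).trans (hM₂ 0)
  have hM₃0 : 0 ≤ M₃ := (norm_nonneg _).trans (hM₃ 0)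
  have hM₄0 : 0 ≤ M₄ := (norm_nonneg _).trans (hM₄ 0)
  have hM₅0 : 0 ≤ M₅ := (ContinuousLinearMap.opNorm_nonneg _).trans (hM₅ 0)
  have hΦ₁ := (norm_fderiv_sub_le_of_global hF hM₂ (WithLp.toLp 2 (klFermiPoint ν K' θ)) (WithLp.toLp 2 (klFermiPoint ν K θ))).trans
    (mul_le_mul_of_nonneg_left d0 hM₂0)
  have hΦ₂ := (norm_fderiv_two_sub_le_of_global hF hM₃ (WithLp.toLp 2 (klFermiPoint ν K' θ))
    (WithLp.toLp 2 (klFermiPoint ν K θ))).trans (mul_le_mul_of_nonneg_left d0 hM₃0)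
  have hΦ₃ := (norm_fderiv_three_sub_le_of_global hF hM₄ (WithLp.toLp 2 (klFermiPoint ν K' θ))
    (WithLp.toLp 2 (klFermiPoint ν K θ))).trans (mul_le_mul_of_nonneg_left d0 hM₄0)
  have hΦ₄ := (norm_fderiv_four_sub_le_of_global hF hM₅ (WithLp.toLp 2 (klFermiPoint ν K' θ))
    (WithLp.toLp 2 (klFermiPoint ν K θ))).trans (mul_le_mul_of_nonneg_left d0 hM₅0)
  have h := abs_iteratedDeriv_four_comp_sub_le (hF.of_le (by norm_num)) hγ hγ' (hM₁ _) (hM₂ _) (hM₃ _) (hM₄ _) hΦ₁ hΦ₂ hΦ₃ hΦ₄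
    g1 g1' g2 g2' g3 g3' g4' d1 d2 d3 d4
  refine h.trans ?_
  have hl0 : 0 ≤ l := zero_le_one.trans hl
  have m3b : M₃ * (e * l ^ 1) ≤ M₃ * (e * l ^ 2) := graded_mono_mul hM₃0 he hl (by norm_num)
  have m2 : M₂ * (e * l ^ 2) ≤ M₂ * (e * l ^ 3) := graded_mono_mul hM₂0 he hl (by norm_num)
  have n2 : M₂ * (e₀ * l ^ 1) ≤ M₂ * (e₀ * l ^ 2) := graded_mono_mul hM₂0 he₀ hl (by norm_num)
  have n3 : M₃ * (e₀ * l ^ 0) ≤ M₃ * (e₀ * l ^ 1) := graded_mono_mul hM₃0 he₀ hl (by norm_num)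
  simp only [pow_zero, mul_one, pow_one] at m3b n2 n3
  have z1 : 0 ≤ M₂ * (e * l ^ 3) := mul_nonneg hM₂0 (by positivity)
  have z2 : 0 ≤ M₃ * (e * l ^ 2) := mul_nonneg hM₃0 (by positivity)
  have z3 : 0 ≤ M₄ * (e * l) := mul_nonneg hM₄0 (by positivity)
  have z4 : 0 ≤ M₂ * (e₀ * l ^ 2) := mul_nonneg hM₂0 (by positivity)
  have z5 : 0 ≤ M₃ * (e₀ * l) := mul_nonneg hM₃0 (by positivity)
  have z6 : 0 ≤ M₄ * e₀ := mul_nonneg hM₄0 he₀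
  have z7 : 0 ≤ M₅ * e₀ := mul_nonneg hM₅0 he₀
  have z8 : 0 ≤ M₁ * (e * l ^ 4) := mul_nonneg hM₁0 (by positivity)
  clear h hΦ₁ hΦ₂ hΦ₃ hΦ₄ d0 d1 d2 d3 d4 g1 g1' g2 g2' g3 g3' g4' hγ hγ'
  linarith

end CompGraded


/-! ## §3 Keyed by the increment `H` (`K′.eval = K.eval + H.eval`) -/

section Increment

variable {K K' H : TrigPolyC4v} (hH : ∀ p : Fin 2 → ℝ, H.eval p = K'.eval p - K.eval p) {A : ℝ}
  (hA : ∀ p : Momentum, ∀ j ≤ 2, ‖iteratedFDeriv ℝ j (frameShift K) p‖ ≤ A)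
  (hA' : ∀ p : Momentum, ∀ j ≤ 2, ‖iteratedFDeriv ℝ j (frameShift K') p‖ ≤ A) (hA20 : A ≤ 1 / 20)
  (hd : klCurveD ≤ (bandBounds (show (-4 : ℝ) < -1.1 by norm_num) (show (-1.1 : ℝ) ≤ -0.1 by norm_num)
    (show (-0.1 : ℝ) < 0 by norm_num)).Dtmin - 2 * A)
  {ν : ℝ} (hlo : (-1.1 : ℝ) ≤ ν - A) (hhi : ν + A ≤ -0.1)
  {A₃ A₄ η η₀ l : ℝ} (hη : 0 ≤ η) (hη₀ : 0 ≤ η₀) (hl : 1 ≤ l)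
  (hA₃ : ∀ p : Momentum, ‖iteratedFDeriv ℝ 3 (frameShift K) p‖ ≤ A₃)
  (hA₃' : ∀ p : Momentum, ‖iteratedFDeriv ℝ 3 (frameShift K') p‖ ≤ A₃) (hA₃l : A₃ ≤ l)
  (hA₄ : ∀ p : Momentum, ‖iteratedFDeriv ℝ 4 (frameShift K) p‖ ≤ A₄)
  (hA₄' : ∀ p : Momentum, ‖iteratedFDeriv ℝ 4 (frameShift K') p‖ ≤ A₄) (hA₄l : A₄ ≤ l ^ 2)
  {h : ℕ → ℝ} (hh : ∀ j ≤ 4, ∀ q : Momentum, ‖iteratedFDeriv ℝ j (frameShift H) q‖ ≤ h j) (hh0 : h 0 ≤ η₀)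
  (hhη : ∀ j, 1 ≤ j → j ≤ 4 → h j ≤ η * l ^ j)
  {F : Momentum → ℝ} (hF : ContDiff ℝ 5 F) {M₁ M₂ M₃ M₄ M₅ : ℝ}
  (hM₁ : ∀ z, ‖fderiv ℝ F z‖ ≤ M₁) (hM₂ : ∀ z, ‖fderiv ℝ (fderiv ℝ F) z‖ ≤ M₂)
  (hM₃ : ∀ z, ‖fderiv ℝ (fderiv ℝ (fderiv ℝ F)) z‖ ≤ M₃) (hM₄ : ∀ z, ‖fderiv ℝ (fderiv ℝ (fderiv ℝ (fderiv ℝ F))) z‖ ≤ M₄)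
  (hM₅ : ∀ z, ‖fderiv ℝ (fderiv ℝ (fderiv ℝ (fderiv ℝ (fderiv ℝ F)))) z‖ ≤ M₅)
include hH hl hA₃l hA₄l hh hh0 hhη

/-- The two-parameter graded hypotheses hold with `(e, e₀, λ) := (η, η₀, 2λ)` when the increment has `‖frameShift H‖ ≤ η₀` and
`‖Dʲ frameShift H‖ ≤ η·λ^j` (`1 ≤ j ≤ 4`). [folklore] -/
theorem graded₂_hyps_of_increment :
    (∀ k : Fin 2 → ℝ, (∀ i, |k i| ≤ π) → |(fun p : Fin 2 → ℝ => -K'.eval p) k - (fun p : Fin 2 → ℝ => -K.eval p) k| ≤ η₀) ∧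
    (∀ k : Fin 2 → ℝ, (∀ i, |k i| ≤ π) →
      ‖fderiv ℝ (fun p : Fin 2 → ℝ => -K'.eval p) k - fderiv ℝ (fun p : Fin 2 → ℝ => -K.eval p) k‖ ≤ η * (2 * l)) ∧
    (∀ k : Fin 2 → ℝ, (∀ i, |k i| ≤ π) →
      ‖fderiv ℝ (fderiv ℝ (fun p : Fin 2 → ℝ => -K'.eval p)) k - fderiv ℝ (fderiv ℝ (fun p : Fin 2 → ℝ => -K.eval p)) k‖ ≤
        η * (2 * l) ^ 2) ∧
    (∀ k : Fin 2 → ℝ, (∀ i, |k i| ≤ π) →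
      ‖fderiv ℝ (fderiv ℝ (fderiv ℝ (fun p : Fin 2 → ℝ => -K'.eval p))) k -
        fderiv ℝ (fderiv ℝ (fderiv ℝ (fun p : Fin 2 → ℝ => -K.eval p))) k‖ ≤ η * (2 * l) ^ 3) ∧
    (∀ k : Fin 2 → ℝ, (∀ i, |k i| ≤ π) →
      ‖fderiv ℝ (fderiv ℝ (fderiv ℝ (fderiv ℝ (fun p : Fin 2 → ℝ => -K'.eval p)))) k -
        fderiv ℝ (fderiv ℝ (fderiv ℝ (fderiv ℝ (fun p : Fin 2 → ℝ => -K.eval p)))) k‖ ≤ η * (2 * l) ^ 4) ∧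
    1 ≤ 2 * l ∧ A₃ ≤ 2 * l ∧ A₄ ≤ (2 * l) ^ 2 := by
  obtain ⟨t0, t1, t2, t3, t4⟩ := frame_diff_transport hH hh
  have g1 := hhη 1 le_rfl (by norm_num); have g2 := hhη 2 (by norm_num) (by norm_num)
  have g3 := hhη 3 (by norm_num) (by norm_num); have g4 := hhη 4 (by norm_num) le_rfl
  have hl0 : 0 ≤ l := zero_le_one.trans hl
  refine ⟨fun k hk => (t0 k hk).trans hh0, fun k hk => (t1 k hk).trans (by linarith),
    fun k hk => (t2 k hk).trans (by nlinarith), fun k hk => (t3 k hk).trans (by nlinarith), fun k hk => (t4 k hk).trans (by nlinarith),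
    by linarith, by linarith, by nlinarith⟩

include hA hA' hA20 hd hlo hhi hη hη₀ hA₃ hA₃' hA₄ hA₄' hF hM₁ in
/-- **Order 0, keyed by the increment**: `|F(γ_{K′}θ) − F(γ_Kθ)| ≤ 12.2·M₁·η₀`. [folklore] -/
theorem abs_comp_sub_le_graded₂_zero_of_increment (θ : ℝ) :
    |F (WithLp.toLp 2 (klFermiPoint ν K' θ)) - F (WithLp.toLp 2 (klFermiPoint ν K θ))| ≤ 12.2 * M₁ * η₀ := by
  obtain ⟨s0, s1, s2, s3, s4, hl2, hA₃2, hA₄2⟩ := graded₂_hyps_of_increment hH hl hA₃l hA₄l hh hh0 hhη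
  exact abs_comp_sub_le_graded₂_zero hA hA' hA20 hd hlo hhi hη hη₀ hl2 hA₃ hA₃' hA₃2 hA₄ hA₄' hA₄2 s0 s1 s2 s3 s4 hF hM₁ θ

include hA hA' hA20 hd hlo hhi hη hη₀ hA₃ hA₃' hA₄ hA₄' hF hM₁ hM₂ hM₃ hM₄ hM₅ in
/-- **Order 4, keyed by the increment**: the `…_graded₂_four` numerals read at `(e, e₀, λ) := (η, η₀, 2λ)`. (Orders 1–3: the same call with
`…_graded₂_one/_two/_three`.) [folklore] -/
theorem abs_iteratedDeriv_four_comp_sub_le_graded₂_of_increment (θ : ℝ) :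
    |iteratedDeriv 4 (F ∘ fun θ : ℝ => (WithLp.toLp 2 (klFermiPoint ν K' θ) : Momentum)) θ -
        iteratedDeriv 4 (F ∘ fun θ : ℝ => (WithLp.toLp 2 (klFermiPoint ν K θ) : Momentum)) θ| ≤
      η * (4300000000000000 * M₁ * (2 * l) ^ 4 + 276000000000000 * M₂ * (2 * l) ^ 3 + 6890000000000 * M₃ * (2 * l) ^ 2 +
          70100000000 * M₄ * (2 * l)) +
        η₀ * (114000000000000000 * M₁ * (2 * l) ^ 2 + 8490000000000000 * M₂ * (2 * l) ^ 2 + 272000000000000 * M₃ * (2 * l) +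
          4530000000000 * M₄ + 34800000000 * M₅) + 69200000000 * M₁ * A₄ := by
  obtain ⟨s0, s1, s2, s3, s4, hl2, hA₃2, hA₄2⟩ := graded₂_hyps_of_increment hH hl hA₃l hA₄l hh hh0 hhη
  exact abs_iteratedDeriv_comp_sub_le_graded₂_four hA hA' hA20 hd hlo hhi hη hη₀ hl2 hA₃ hA₃' hA₃2 hA₄ hA₄' hA₄2 s0 s1 s2 s3 s4 hF hM₁
    hM₂ hM₃ hM₄ hM₅ θ

end Increment

end Summit.HubbardSuperconductivity.HubbardSuperconductivity.Theorems.PerturbedFermiCurve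

end
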